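import Literature.NumberTheory.EllipticCurves.Rank1Residual.Typed.X5DescentItem
import Literature.NumberTheory.EllipticCurves.SelmerProofs
import Literature.NumberTheory.EllipticCurves.SelmerTorsionInclusion
import HarnessLib

/-!
# X5 (p = 2): the mode-A item certificate over the tree's Selmer groups

Support file for the BSD rank-≤ 1 residual programme, class X5 (`p = 2`, every `E/ℚ` of analytic
rank `≤ 1`), unit `b2b-bsdres-sha-1` (gen 5). Everything here is proved; the only named facts
that enter are the HYPOTHESES `hGZK` (Gross–Zagier–Kolyvagin, as everywhere in the lane) and
`hCT : WeierstrassCurve.exists_casselsTate_pairing` (bsd.S18, Cassels 1962 / Silverman X.4.14) of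
the consumer `X5.bsdp_two_of_casselsTate_item` (file `X5DescentItem`).

File `X5DescentItem` proved the ITEM FORM of the engine-H mode-A certificate over an ABSTRACT
Kummer–Selmer diagram `(S₄, S₈, X, π₄, π₈, d)` with three hypotheses `hcomm`, `hsurj`, `hker`.
This file INSTANTIATES the diagram with the tree's objects and DISCHARGES the three hypotheses:

* `S_n := Sel^(n)(E/K)` (`WeierstrassCurve.selmerGroup W n`, Silverman X.§4), `X := Ш(E/K)`
  (`WeierstrassCurve.sha`), `π_n : Sel^(n)(E/K) → Ш(E/K)` the restriction of
  `H¹(K, E[n]) → H¹(K, E)` (`WeierstrassCurve.selmerToSha`, well defined by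
  `selmerGroup_eq_comap_sha`);
* `d := [m]_* : H¹(K, E[n]) → H¹(K, E[d])` for `n ∣ d·m`, the map induced on continuous Galois
  cohomology by the equivariant homomorphism `m · : E[n] → E[d]`
  (`WeierstrassCurve.torsionH1ZSMul`, via `Literature.NumberTheory.EllipticCurves.resH1Hom` =
  Mathlib's `ContinuousCohomology.map`), and its restriction `Sel^(n) → Sel^(d)`
  (`WeierstrassCurve.selmerZSMul`);
* `hcomm` — `π_d ∘ [m]_* = m · π_n` (`torsionH1ToH1_torsionH1ZSMul`, functoriality of `H¹` on
  explicit cocycles, Serre I.§2.4);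
* `hsurj` — `Sel^(n)(E/K) ↠ Ш(E/K)[n]` (`exists_selmerToSha_eq`, the tree's PROVED
  `map_torsionH1ToH1_selmerGroup_holds`, Silverman X.4.2(a));
* `hker` — `ker π_d|Sel^(d) ⊆ [m]_* Sel^(n)` for `n = d·m` (`exists_selmerZSMul_eq_of_selmerToSha_eq_zero`):
  a Selmer class dying in `H¹(K, E)` is a Kummer class `κ_d(P)` (the tree's PROVED
  `mem_range_kummerMapTorsion_of_torsionH1ToH1_eq_zero` and `zsmul_geomPoints_surjective_holds`,
  Silverman VIII.§2), and `[m]_* κ_n(P) = κ_d(P)` on the nose: for `nR = P` the cocycle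
  `σ ↦ m(σR − R) = σ(mR) − mR` is the Kummer cocycle of `mR`, `d(mR) = P`
  (`torsionH1ZSMul_kummerMapTorsion`).

Consequence (`X5.bsdp_two_of_selmer_item`, over `ℚ`, levels `4 | 8`): granted GZK and bsd.S18,
for `E/ℚ` of analytic rank `≤ 1` with `#Ш[2] = 4`, `Ш[2] ⊆ 2Ш`, `#Ш[4] = 16`, `ord₂ #Ш_an = 4`,
ONE Selmer class `s ∈ Sel^(4)(E/ℚ)` with `2·π₄(s) ≠ 0` (a 4-covering above a 2-covering that
represents a non-zero element of `Ш`, i.e. is not the image of a rational point) and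
`s ∉ [2]_* Sel^(8)(E/ℚ)` (NO 8-covering above it is everywhere locally soluble — Stamminger's
"empty fake Selmer set" verdict for this single 4-covering) gives `BSD(E, 2)`. This is the
precise tree-level meaning of one engine-H item of the census (`SHA-CENSUS.md` §2.7, §3.6;
`METHOD-H.md` §3 (iv′)); no abstract hypothesis of file `X5DescentItem` remains.

References: Silverman, *AEC* (2009), VIII.§2, X.§4 (Thm. X.4.2), X.4.14; Serre, *Galois
Cohomology*, I.§2; Cassels (1962, Arithmetic IV); Stamminger (2005), Thm. 6.2.2;
Cremona–Fisher–O'Neil–Simon–Stoll (2008), §1.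
-/

noncomputable section

open scoped Classical

universe u

namespace WeierstrassCurve

open Literature.NumberTheory.GaloisRepresentations Literature.NumberTheory.EllipticCurves

variable {K : Type u} [Field K] (W : WeierstrassCurve K)

/-! ## `[m]_* : H¹(K, E[n]) → H¹(K, E[d])` -/

/-- The map `[m]_* : H¹(K, E[n]) → H¹(K, E[d])` induced on continuous Galois cohomology by the
`Γ_K`-equivariant homomorphism `m · : E[n] → E[d]` (`n ∣ d·m`; `WeierstrassCurve.geomTorsionZSMul`),
i.e. the map of the compatible pair `(id_{Γ_K}, m ·)` (Mathlib's `ContinuousCohomology.map`).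
For `n = 8`, `d = 4`, `m = 2` this is the map `Sel^(8) → Sel^(4)` "forget to a 4-covering" of
higher descent. [cite: SilvermanAEC2009, X.§4 (functoriality of H¹(K, E[m]) in m, proof of X.4.2); Stamminger2005, §1.3] -/
def torsionH1ZSMul {d n : ℤ} (m : ℤ) (hm : n ∣ d * m) : galH1Torsion W n →+ galH1Torsion W d :=
  resH1Hom (ContinuousMonoidHom.id (Field.absoluteGaloisGroup K)) (geomTorsionZSMul W m hm)
    fun σ P ↦ geomTorsionZSMul_smul W m hm σ P

/-- **Compatibility `π_d ∘ [m]_* = m · π_n`**: the composite `H¹(K, E[n]) →[m]_* H¹(K, E[d]) → H¹(K, E)`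
is `m` times `H¹(K, E[n]) → H¹(K, E)` (both are computed on an explicit continuous cocycle `φ`:
`σ ↦ m·φ(σ)` in `E(K̄)`). [cite: SilvermanAEC2009, X.§4 (proof of X.4.2: functoriality of the Kummer diagram); Stamminger2005, §1.3] -/
theorem torsionH1ToH1_torsionH1ZSMul {d n : ℤ} (m : ℤ) (hm : n ∣ d * m) (z : galH1Torsion W n) :
    torsionH1ToH1 W d (torsionH1ZSMul W m hm z) = m • torsionH1ToH1 W n z := by
  obtain ⟨φ, rfl⟩ := oneCocycleClass_surjective _ z
  change resH1Hom (ContinuousMonoidHom.id (Field.absoluteGaloisGroup K)) (geomTorsion W d).subtype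
      (fun _ _ ↦ rfl) (resH1Hom (ContinuousMonoidHom.id (Field.absoluteGaloisGroup K))
        (geomTorsionZSMul W m hm) (fun σ P ↦ geomTorsionZSMul_smul W m hm σ P)
          (oneCocycleClass _ φ)) =
    m • resH1Hom (ContinuousMonoidHom.id (Field.absoluteGaloisGroup K)) (geomTorsion W n).subtype
      (fun _ _ ↦ rfl) (oneCocycleClass _ φ)
  have key : contOneCocycles.push (geomTorsion W d).subtype (fun _ _ ↦ rfl)
      (contOneCocycles.push (geomTorsionZSMul W m hm) (fun σ P ↦ geomTorsionZSMul_smul W m hm σ P)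
        φ) =
      m • contOneCocycles.push (geomTorsion W n).subtype (fun _ _ ↦ rfl) φ := by
    apply Subtype.ext
    ext σ : 1
    rfl
  rw [resH1Hom_id_oneCocycleClass, resH1Hom_id_oneCocycleClass, resH1Hom_id_oneCocycleClass, key,
    ← oneCocycleClassₗ_apply, ← oneCocycleClassₗ_apply, map_zsmul]

section NumberField

variable [NumberField K]

/-- `[m]_*` maps `Sel^(n)(E/K)` into `Sel^(d)(E/K)` (`n ∣ d·m`): both Selmer groups are the
preimages of `Ш(E/K)` (`selmerGroup_eq_comap_sha`) and `π_d ∘ [m]_* = m · π_n`.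
[cite: SilvermanAEC2009, X.§4 (definition of the Selmer group, diagram (**)); Stamminger2005, §1.3] -/
theorem torsionH1ZSMul_mem_selmerGroup {d n : ℤ} (m : ℤ) (hm : n ∣ d * m) {z : galH1Torsion W n}
    (hz : z ∈ selmerGroup W n) : torsionH1ZSMul W m hm z ∈ selmerGroup W d := by
  rw [selmerGroup_eq_comap_sha, AddSubgroup.mem_comap] at hz ⊢
  rw [torsionH1ToH1_torsionH1ZSMul]
  exact W.sha.zsmul_mem hz m

/-! ## `π_n : Sel^(n)(E/K) → Ш(E/K)` and `[m]_* : Sel^(n)(E/K) → Sel^(d)(E/K)` -/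

/-- `π_n : Sel^(n)(E/K) → Ш(E/K)`, the restriction of `H¹(K, E[n]) → H¹(K, E)` to the Selmer
group, landing in `Ш` (`selmerGroup_eq_comap_sha`). [cite: SilvermanAEC2009, Thm. X.4.2(a) (the map Sel^(m) → Ш[m])] -/
def selmerToSha (n : ℤ) : selmerGroup W n →+ W.sha :=
  ((torsionH1ToH1 W n).comp (selmerGroup W n).subtype).codRestrict W.sha fun s ↦ by
    have h : (s : galH1Torsion W n) ∈ W.sha.comap (torsionH1ToH1 W n) := by
      rw [← selmerGroup_eq_comap_sha]; exact s.2
    exact h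

/-- Unfolding `selmerToSha`. [cite: SilvermanAEC2009, Thm. X.4.2(a)] -/
@[simp]
theorem coe_selmerToSha (n : ℤ) (s : selmerGroup W n) :
    ((selmerToSha W n s : W.sha) : W.galH1) = torsionH1ToH1 W n s :=
  rfl

/-- `π_n` lands in `Ш[n]`: `n · π_n(s) = 0` (`H¹(K, E[n]) → H¹(K, E)` has image in `H¹(K, E)[n]`).
[cite: SilvermanAEC2009, Thm. X.4.2(a)] -/
theorem zsmul_selmerToSha (n : ℤ) (s : selmerGroup W n) : n • selmerToSha W n s = 0 := by
  apply Subtype.ext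
  change n • torsionH1ToH1 W n (s : galH1Torsion W n) = 0
  exact torsionH1ToH1_mem_torsionBy W n (s : galH1Torsion W n)

/-- `[m]_* : Sel^(n)(E/K) → Sel^(d)(E/K)` (`n ∣ d·m`), the restriction of `torsionH1ZSMul`.
[cite: SilvermanAEC2009, X.§4; Stamminger2005, §1.3 (the maps between higher Selmer groups)] -/
def selmerZSMul {d n : ℤ} (m : ℤ) (hm : n ∣ d * m) : selmerGroup W n →+ selmerGroup W d :=
  ((torsionH1ZSMul W m hm).comp (selmerGroup W n).subtype).codRestrict (selmerGroup W d)
    fun z ↦ torsionH1ZSMul_mem_selmerGroup W m hm z.2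

/-- Unfolding `selmerZSMul`. [cite: SilvermanAEC2009, X.§4] -/
@[simp]
theorem coe_selmerZSMul {d n : ℤ} (m : ℤ) (hm : n ∣ d * m) (z : selmerGroup W n) :
    ((selmerZSMul W m hm z : selmerGroup W d) : galH1Torsion W d) = torsionH1ZSMul W m hm z :=
  rfl

/-- **`hcomm`**: `π_d ([m]_* z) = m · π_n(z)` in `Ш(E/K)`. [cite: SilvermanAEC2009, X.§4 (proof of X.4.2); Stamminger2005, §1.3] -/
theorem selmerToSha_selmerZSMul {d n : ℤ} (m : ℤ) (hm : n ∣ d * m) (z : selmerGroup W n) :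
    selmerToSha W d (selmerZSMul W m hm z) = m • selmerToSha W n z :=
  Subtype.ext (by
    simp only [coe_selmerToSha, coe_selmerZSMul, AddSubgroupClass.coe_zsmul]
    exact torsionH1ToH1_torsionH1ZSMul W m hm z)

/-- **`hsurj`**: `Sel^(n)(E/K) → Ш(E/K)[n]` is onto (`n ≠ 0`) — the surjectivity half of the
fundamental exact sequence, the tree's proved `map_torsionH1ToH1_selmerGroup_holds`.
[cite: SilvermanAEC2009, Thm. X.4.2(a)] -/
theorem exists_selmerToSha_eq {n : ℤ} (hn : n ≠ 0) (w : W.sha) (hw : n • w = 0) :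
    ∃ z : selmerGroup W n, selmerToSha W n z = w := by
  have hw' : (w : W.galH1) ∈ (selmerGroup W n).map (torsionH1ToH1 W n) := by
    rw [map_torsionH1ToH1_selmerGroup_holds W hn]
    have hw0 : n • (w : W.galH1) = 0 := by
      rw [← AddSubgroupClass.coe_zsmul, hw]
      rfl
    exact AddSubgroup.mem_inf.mpr ⟨w.2, hw0⟩
  obtain ⟨z, hz, hzw⟩ := AddSubgroup.mem_map.mp hw'
  exact ⟨⟨z, hz⟩, Subtype.ext hzw⟩

/-! ## The Kummer map and `[m]_*` -/

/-- The Kummer map `κ_n : E(K) → H¹(K, E[n])` lands in `Sel^(n)(E/K)` (it satisfies every local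
condition, `kummerMapTorsion_mem_selmerLocalKer`). [cite: SilvermanAEC2009, Thm. X.4.2(a) (image of E(K)/mE(K) in the Selmer group)] -/
theorem kummerMapTorsion_mem_selmerGroup (n : ℤ)
    (hdiv : ∀ P : geomPoints W, ∃ Q : geomPoints W, n • Q = P) (P : W.toAffine.Point) :
    kummerMapTorsion W n hdiv P ∈ selmerGroup W n :=
  (mem_selmerGroup_iff W n _).mpr
    ⟨fun v ↦ kummerMapTorsion_mem_selmerLocalKer W n hdiv (v.adicCompletion K) P,
      fun w ↦ kummerMapTorsion_mem_selmerLocalKer W n hdiv w.Completion P⟩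

omit [NumberField K] in
/-- **`[m]_* κ_n = κ_d`** (`d·m = n`): for `nR = P` the class `[m]_*[σ ↦ σR − R] = [σ ↦ σ(mR) − mR]`
is the Kummer class at level `d` of `mR`, and `d(mR) = P`. [cite: SilvermanAEC2009, VIII.§2 (the Kummer pairing is compatible with [m]); Stamminger2005, §1.3] -/
theorem torsionH1ZSMul_kummerMapTorsion {d n : ℤ} (m : ℤ) (hmn : d * m = n)
    (hdivn : ∀ P : geomPoints W, ∃ Q : geomPoints W, n • Q = P)
    (hdivd : ∀ P : geomPoints W, ∃ Q : geomPoints W, d • Q = P) (P : W.toAffine.Point) :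
    torsionH1ZSMul W m (hmn ▸ dvd_refl _) (kummerMapTorsion W n hdivn P) =
      kummerMapTorsion W d hdivd P := by
  have hm : n ∣ d * m := hmn ▸ dvd_refl _
  set R := zsmulRoot W n hdivn P with hR
  have hRP : n • R = toGeomPoints W P := zsmul_zsmulRoot W n hdivn P
  have hQ : d • (m • R) = toGeomPoints W P := by rw [smul_smul, hmn, hRP]
  rw [kummerMapTorsion_apply W d, kummerMapTorsionFun_eq W d hdivd P (m • R) hQ,
    kummerMapTorsion_apply W n]
  change torsionH1ZSMul W m hm (kummerClassTorsion W n R (zsmul_zsmulRoot_mem W n hdivn P)) = _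
  unfold kummerClassTorsion torsionH1ZSMul
  rw [resH1Hom_id_oneCocycleClass]
  congr 1
  apply Subtype.ext
  ext σ : 1
  apply Subtype.ext
  change m • (σ • R - R) = σ • (m • R) - m • R
  rw [smul_sub, smul_comm]

/-- **`hker`**: a class of `Sel^(d)(E/K)` dying in `H¹(K, E)` lies in `[m]_* Sel^(n)(E/K)`
(`d·m = n ≠ 0`, `E` an elliptic curve): it is a Kummer class `κ_d(P)` (exactness of the Kummer
sequence at `H¹(K, E[d])`, the tree's proved `mem_range_kummerMapTorsion_of_torsionH1ToH1_eq_zero`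
with the divisibility of `E(K̄)`, `zsmul_geomPoints_surjective_holds`), and `κ_d(P) = [m]_* κ_n(P)`
with `κ_n(P) ∈ Sel^(n)(E/K)`. [cite: SilvermanAEC2009, VIII.§2 and Thm. X.4.2(a)] -/
theorem exists_selmerZSMul_eq_of_selmerToSha_eq_zero [W.IsElliptic] {d n : ℤ} (m : ℤ)
    (hmn : d * m = n) (hn : n ≠ 0) (s : selmerGroup W d) (hs : selmerToSha W d s = 0) :
    ∃ z : selmerGroup W n, selmerZSMul W m (hmn ▸ dvd_refl _) z = s := by
  have hd : d ≠ 0 := by rintro rfl; exact hn (by rw [← hmn, zero_mul])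
  have hdivn : ∀ P : geomPoints W, ∃ Q : geomPoints W, n • Q = P :=
    fun P ↦ zsmul_geomPoints_surjective_holds W hn P
  have hdivd : ∀ P : geomPoints W, ∃ Q : geomPoints W, d • Q = P :=
    fun P ↦ zsmul_geomPoints_surjective_holds W hd P
  have hs0 : torsionH1ToH1 W d (s : galH1Torsion W d) = 0 := by
    simpa using congrArg Subtype.val hs
  obtain ⟨P, hP⟩ := mem_range_kummerMapTorsion_of_torsionH1ToH1_eq_zero W d hdivd _ hs0
  refine ⟨⟨kummerMapTorsion W n hdivn P, kummerMapTorsion_mem_selmerGroup W n hdivn P⟩,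
    Subtype.ext ?_⟩
  rw [coe_selmerZSMul]
  change torsionH1ZSMul W m _ (kummerMapTorsion W n hdivn P) = (s : galH1Torsion W d)
  rw [torsionH1ZSMul_kummerMapTorsion W m hmn hdivn hdivd P, hP]

end NumberField

end WeierstrassCurve

/-! ## X5 over `ℚ`: one Selmer class certifies `Ш[8] = Ш[4]` -/

namespace Literature.NumberTheory.EllipticCurves.Rank1Residual.Typed

open WeierstrassCurve

variable (W : WeierstrassCurve ℚ) [W.IsElliptic] [W.IsGloballyMinimal]

/-- Arithmetic side condition `8 ∣ 4·2` for `[2]_* : Sel^(8) → Sel^(4)` (content-free private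
helper). [folklore] -/
private theorem eight_dvd : (8 : ℤ) ∣ 4 * 2 := by norm_num

/-- **X5, `p = 2`: ONE item of the explicit 8-descent certifies `BSD(E, 2)` on the census core**
(granted GZK and the Cassels–Tate pairing bsd.S18). Hypotheses, all per-curve certificate lines
except `hGZK`, `hCT`: analytic rank `≤ 1`; `#Ш[2] = 4`; `Ш[2] ⊆ 2Ш` (the three `Ш`-type
2-coverings lift); `#Ш[4] = 16`; `#Ш_an = q` with `ord₂ q = 4`; and ONE Selmer class
`s ∈ Sel^(4)(E/ℚ)` with `2·π₄(s) ≠ 0` in `Ш` (the 2-covering below `s` is not the image of a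
rational point) such that NO `z ∈ Sel^(8)(E/ℚ)` has `[2]_* z = s` (no everywhere-locally-soluble
8-covering lies above the 4-covering `s`: the "EMPTY fake Selmer set" verdict). Proof: the abstract
item theorem `X5.bsdp_two_of_casselsTate_item` on the diagram
`(Sel^(4), Sel^(8), Ш, π₄, π₈, [2]_*)`, whose hypotheses `hcomm`, `hsurj`, `hker` are the proved
`selmerToSha_selmerZSMul`, `exists_selmerToSha_eq`, `exists_selmerZSMul_eq_of_selmerToSha_eq_zero`.
[cite: Stamminger2005, Thm. 6.2.2 and §1.3; SilvermanAEC2009, Thm. X.4.2(a), Thm. X.4.14; Cassels1962ArithmeticIV, Thm. 1.1] -/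
theorem X5.bsdp_two_of_selmer_item (hGZK : rank_eq_analyticRank_of_analyticRank_le_one)
    (hCT : WeierstrassCurve.exists_casselsTate_pairing (K := ℚ)) (hr : W.analyticRank ≤ 1)
    (h2 : Nat.card (AddSubgroup.torsionBy W.sha 2) = 4)
    (hdiv : ∀ z : W.sha, 2 • z = 0 → ∃ w : W.sha, 2 • w = z)
    {s : W.selmerGroup 4} (hξ : 2 • W.selmerToSha 4 s ≠ 0)
    (hs : ¬ ∃ z : W.selmerGroup 8, W.selmerZSMul 2 eight_dvd z = s)
    (hcard : Nat.card (AddSubgroup.torsionBy W.sha 4) = 16) {q : ℚ} (hq : shaAn W = (q : ℂ))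
    (hv : padicValRat 2 q = 4) : BSDp W 2 := by
  refine X5.bsdp_two_of_casselsTate_item W hGZK hCT hr h2 hdiv (W.selmerToSha 4) (W.selmerToSha 8)
    (W.selmerZSMul 2 eight_dvd) (fun z ↦ ?_) (fun w hw ↦ ?_) (fun s' hs' ↦ ?_) ?_ hξ hs hcard hq hv
  · -- hcomm
    rw [selmerToSha_selmerZSMul]
    exact ofNat_zsmul _ _
  · -- hsurj
    exact W.exists_selmerToSha_eq (by norm_num) w (by rw [ofNat_zsmul]; exact hw)
  · -- hker
    exact W.exists_selmerZSMul_eq_of_selmerToSha_eq_zero 2 (by norm_num) (by norm_num) s' hs'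
  · -- 4 • π₄ s = 0
    have h := W.zsmul_selmerToSha 4 s
    rwa [ofNat_zsmul] at h

end Literature.NumberTheory.EllipticCurves.Rank1Residual.Typed

end
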